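import Summits.BirchSwinnertonDyer.Rank1Residual.X6.RankZeroCertificateSchema
import Summits.BirchSwinnertonDyer.Rank1Residual.Supersingular.KobayashiMainConjectureX6BSTWScope
import Summits.BirchSwinnertonDyer.Rank1Residual.Supersingular.X6KuriharaOfferShape
import Summits.BirchSwinnertonDyer.Rank1Residual.SecondDescent.CanaryTargetsClassCertificates
import Summits.BirchSwinnertonDyer.Rank1Residual.Supersingular.RankOneRem13RecordShapesCount
import Literature.NumberTheory.EllipticCurves.Rank1Residual.X11RankOneCertificates.Minimality
import Literature.NumberTheory.EllipticCurves.Rank1Residual.Typed.CasselsLowerBound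
import Literature.NumberTheory.QuadraticFields.ClassNumberOneGenus
import Mathlib.NumberTheory.LegendreSymbol.JacobiSymbol
import HarnessLib

/-!
# Class X6 ∧ analytic rank `0` — what a certificate record PROVES about its curve (kernel theorems):
# the instance binders, the leaf predicate `ClassX6`, and the BSTW-scope witness

Cell `bsd-print-x6` (D-0131 (2) print tier, key `x6`; HOME `run/shared/lean/pub/bsd-print-x6/`), typer seat ty3.
Companion of `RankZeroCertificateSchema.lean` (record FORMAT + in-kernel recheck), of `RankZeroCertificateClaim.lean`
(what a record CLAIMS, and `BSD(E,p)` per road) and of the data files `RankZeroCertificateRecords*.lean`.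
PARTITION (D-0054): leaf X6 ∧ r = 0 (K3 row A6) — types-the-object-of; closes NONE. HONEST FRAMING: nothing here
asserts BSD or any `L`-value; every theorem below is about the decidable shadow of a record that passed `Record.check`.

* `Record.fact_prime_of_check`, `Record.elliptic_and_minimal_of_check` — the three instance
  binders of the record's model `W = r.curve`: `p` prime (`X11RankOneCertificates.prime_of_isPrimeBelow504100`),
  `Δ ≠ 0`, and GLOBAL MINIMALITY of Cremona's model from `gcd(Δ, c₄) = 1` by Silverman's criterion
  (`X11RankOneCertificates.isGloballyMinimal_of_int_criterion`).
* `Record.classX6_of_check` — **`ClassX6 W p`** from `p ∤ Δ`, `#Ẽ(𝔽_p) = p + 1`, `gcd(Δ, c₄) = 1`, `p = 3 ∨ 5 ≤ p`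
  (the tree's `Supersingular.classX6_of_intModel`, `Supersingular.goodSS_of_intModel`,
  `SecondDescent.semistable_of_intModel_of_gcd_eq_one`, `IntModel.frobeniusTrace_eq`; point count by
  `Supersingular.natCard_point_eq_of_countPoints`).
* `Record.mem_badPrimes_of_not_good` — every bad prime of `W` is listed (`Prime.dvd_prod_iff` on the rechecked
  factorisation `|Δ| = ∏ q^{v_q}`); `Record.mult_and_val_of_mem_bad` — each listed `(q, v)` is a multiplicative prime
  with `ord_q(Δ_min) = v` (`IntModel.hasMultiplicativeReductionAtPrime_of_intModel`, `padicValInt_eq_of_dvd_of_not_dvd`).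
* `Record.hasWitness_of_check` — **`BSTWScope.HasWitness W p`** (the (ram) prime `q₀` and auxiliary field `ℚ(√−D)` of the
  printed proof of BSTW arXiv:2409.01350 Thm. 1.3, §10.3, with the cell's rider `p ∤ h_L`;
  `Supersingular/KobayashiMainConjectureX6BSTWScope.lean`) for a record carrying an auxiliary datum with an ODD inert
  prime: the tree's `BSTWScope.hasWitness_of_kronecker`, Kronecker hypotheses by Euler's criterion
  (`jacobiSym_eq_one_of_isQR` / `jacobiSym_eq_neg_one_of_isQNR` via `powModBin_eq`), class number by
  `BinaryQuadraticForm.binQF_classNumber_eq`, square-freeness by `squarefree_of_trial`.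

References: Silverman *AEC* VII.1 Rem. 1.1, VII.5.1 [SilvermanAEC2009]; Ireland–Rosen Prop. 5.1.2 [IrelandRosen1990];
Cox Thm. 2.13, 7.7(ii) [Cox2013]; Skinner–Urban 2014 (ram) [SkinnerUrban2014]; Burungale–Skinner–Tian–Wan
arXiv:2409.01350v2 §10.3 (PRE; shape of the auxiliary datum only — NOTHING of it is asserted here) [BurungaleSkinnerTianWan2024].
-/

set_option autoImplicit false

noncomputable section

open scoped Classical MatrixGroups ModularForm

open CongruenceSubgroup WeierstrassCurve Literature.NumberTheory.EllipticCurves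
  Literature.NumberTheory.EllipticCurves.ModularForms
  Literature.NumberTheory.EllipticCurves.Rank1Residual
  Literature.NumberTheory.EllipticCurves.Rank1Residual.Typed
  Literature.NumberTheory.EllipticCurves.Rank1Residual.X11RankOneCertificates
  Literature.NumberTheory.QuadraticFields
  Summit.BirchSwinnertonDyer.BirchSwinnertonDyer.Rank1Residual.IntModel
  Summit.BirchSwinnertonDyer.BirchSwinnertonDyer.Rank1Residual.X11RankOne
  Summit.BirchSwinnertonDyer.Rank1Residual.Supersingular

namespace Summit.BirchSwinnertonDyer.Rank1Residual.X6.PrintCert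

/-! ### §1 Euler's criterion: from the recheck's `isQR` / `isQNR` to Mathlib's Jacobi symbol -/

/-- The naive Euler-criterion value, cast to `ZMod q`, is `a^{q/2}` (`q` odd, `(q−1)/2 < 2⁶⁴`). [cite: IrelandRosen1990, Prop. 5.1.2] -/
theorem eulerCrit_cast {a : ℤ} {q : ℕ} (hq : q.Prime) (hq2 : q ≠ 2) (hlt : q < 2 ^ 64) :
    ((eulerCrit a q : ℕ) : ZMod q) = (a : ZMod q) ^ (q / 2) := by
  haveI : NeZero q := ⟨hq.ne_zero⟩
  have hodd : q % 2 = 1 := hq.eq_two_or_odd.resolve_left hq2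
  have he : (q - 1) / 2 = q / 2 := by omega
  rw [eulerCrit, powModBin_eq _ _ _ (by omega), he, ZMod.natCast_mod, Nat.cast_pow]
  congr 1
  have h0 : 0 ≤ a % (q : ℤ) := Int.emod_nonneg _ (by exact_mod_cast hq.ne_zero)
  rw [← Int.cast_natCast (R := ZMod q) (a % (q : ℤ)).toNat, Int.toNat_of_nonneg h0, ZMod.intCast_mod]

/-- `isQR a q` ⇒ `J(a | q) = 1` at an odd prime `q < 2⁶⁴`. [cite: IrelandRosen1990, Prop. 5.1.2] -/
theorem jacobiSym_eq_one_of_isQR {a : ℤ} {q : ℕ} (hq : q.Prime) (hq2 : q ≠ 2) (hlt : q < 2 ^ 64)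
    (h : isQR a q = true) : jacobiSym a q = 1 := by
  haveI : Fact q.Prime := ⟨hq⟩
  have hval : eulerCrit a q = 1 := by simpa [isQR] using h
  have hpow : (legendreSym q a : ZMod q) = 1 := by
    rw [legendreSym.eq_pow, ← eulerCrit_cast hq hq2 hlt, hval, Nat.cast_one]
  rw [← jacobiSym.legendreSym.to_jacobiSym]
  have ha : (a : ZMod q) ≠ 0 := by
    intro ha
    have := (legendreSym.eq_zero_iff q a).mpr ha
    rw [this, Int.cast_zero] at hpow
    exact zero_ne_one hpow
  rcases legendreSym.eq_one_or_neg_one q ha with h1 | h1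
  · exact h1
  · exfalso
    rw [h1, Int.cast_neg, Int.cast_one] at hpow
    have h2 : (2 : ZMod q) = 0 := by linear_combination -hpow
    have : (q : ℤ) ∣ 2 := by
      have := (ZMod.intCast_zmod_eq_zero_iff_dvd 2 q).mp (by exact_mod_cast h2)
      exact this
    have hq2' : q ∣ 2 := by exact_mod_cast this
    have := (Nat.prime_two.eq_one_or_self_of_dvd q hq2')
    rcases this with h | h
    · exact hq.one_lt.ne' h
    · exact hq2 h

/-- `isQNR a q` ⇒ `J(a | q) = −1` at an odd prime `q < 2⁶⁴`. [cite: IrelandRosen1990, Prop. 5.1.2] -/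
theorem jacobiSym_eq_neg_one_of_isQNR {a : ℤ} {q : ℕ} (hq : q.Prime) (hq2 : q ≠ 2) (hlt : q < 2 ^ 64)
    (h : isQNR a q = true) : jacobiSym a q = -1 := by
  haveI : Fact q.Prime := ⟨hq⟩
  have hval : eulerCrit a q = q - 1 := by
    simp only [isQNR, Bool.and_eq_true, decide_eq_true_eq, beq_iff_eq] at h; exact h.2
  have hq1 : ((q - 1 : ℕ) : ZMod q) = -1 := by
    rw [Nat.cast_sub hq.one_lt.le, Nat.cast_one, ZMod.natCast_self, zero_sub]
  have hpow : (legendreSym q a : ZMod q) = -1 := by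
    rw [legendreSym.eq_pow, ← eulerCrit_cast hq hq2 hlt, hval, hq1]
  rw [← jacobiSym.legendreSym.to_jacobiSym]
  have hne : (-1 : ZMod q) ≠ 1 := by
    intro h1
    have h2 : (2 : ZMod q) = 0 := by linear_combination -h1
    have : (q : ℤ) ∣ 2 := (ZMod.intCast_zmod_eq_zero_iff_dvd 2 q).mp (by exact_mod_cast h2)
    have hq2' : q ∣ 2 := by exact_mod_cast this
    rcases Nat.prime_two.eq_one_or_self_of_dvd q hq2' with h | h
    · exact hq.one_lt.ne' h
    · exact hq2 h
  have ha : (a : ZMod q) ≠ 0 := by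
    intro ha
    have h0 := (legendreSym.eq_zero_iff q a).mpr ha
    rw [h0, Int.cast_zero] at hpow
    have h10 : (1 : ZMod q) = 0 := by linear_combination hpow
    exact one_ne_zero h10
  rcases legendreSym.eq_one_or_neg_one q ha with h1 | h1
  · exfalso; rw [h1, Int.cast_one] at hpow; exact hne hpow.symm
  · exact h1

/-! ### §2 The record's curve; instances and `ClassX6` from a passing recheck -/

namespace Record

/-- The Weierstrass equation over `ℚ` with the record's a-invariants (junk: the zero equation when `ainvs`
does not have five entries — excluded by `Record.check`). For the cell's records this is Cremona's
reduced global minimal model of the curve `label`. [folklore] -/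
def curve (r : Record) : WeierstrassCurve ℚ :=
  match r.ainvs with
  | [a₁, a₂, a₃, a₄, a₆] => ⟨a₁, a₂, a₃, a₄, a₆⟩
  | _ => ⟨0, 0, 0, 0, 0⟩

variable (r : Record)

/-- The record's curve when the a-invariants are `[a₁,a₂,a₃,a₄,a₆]` is that literal equation. [folklore] -/
theorem curve_eq {a1 a2 a3 a4 a6 : ℤ} (h : r.ainvs = [a1, a2, a3, a4, a6]) :
    (⟨a1, a2, a3, a4, a6⟩ : WeierstrassCurve ℚ) = r.curve := by
  simp only [curve, h]

/-- A passing record has five a-invariants. [folklore] -/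
theorem exists_ainvs_eq_of_check (hc : r.check = true) :
    ∃ a1 a2 a3 a4 a6 : ℤ, r.ainvs = [a1, a2, a3, a4, a6] := by
  have hlen := (r.support_of_check hc).1
  rcases hA : r.ainvs with _ | ⟨a1, _ | ⟨a2, _ | ⟨a3, _ | ⟨a4, _ | ⟨a6, _ | ⟨x, t⟩⟩⟩⟩⟩⟩ <;>
    simp [hA] at hlen
  exact ⟨a1, a2, a3, a4, a6, rfl⟩

/-- A certified record's `p` is prime (as the instance `Fact r.p.Prime` the tree's predicates expect). [folklore] -/
theorem fact_prime_of_check (hc : r.check = true) : Fact r.p.Prime := by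
  have h' := (r.checks_of_check hc).2.1
  simp only [Record.checkReduction, Bool.and_eq_true, decide_eq_true_eq] at h'
  exact ⟨prime_of_isPrimeBelow504100 h'.1.1.1.1.1⟩

/-- A certified record's `p` is below `504100 < 2⁶⁴`. [folklore] -/
theorem p_lt_of_check (hc : r.check = true) : r.p < 504100 := by
  have h' := (r.checks_of_check hc).2.1
  simp only [Record.checkReduction, Bool.and_eq_true, decide_eq_true_eq, isPrimeBelow504100] at h'
  exact h'.1.1.1.1.1.1.2

/-- **A certified record's model is an elliptic curve AND globally minimal**: the recheck found `Δ(ainvs) ≠ 0`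
and `gcd(Δ, c₄) = 1`, which gives Silverman's criterion (no prime with `q¹² ∣ Δ` and `q⁴ ∣ c₄`;
`X11RankOneCertificates.isGloballyMinimal_of_int_criterion`). [cite: SilvermanAEC2009, VII.1 Remark 1.1] -/
theorem elliptic_and_minimal_of_check (hc : r.check = true) :
    r.curve.IsElliptic ∧ r.curve.IsGloballyMinimal := by
  obtain ⟨a1, a2, a3, a4, a6, hA⟩ := r.exists_ainvs_eq_of_check hc
  obtain ⟨-, hne, hg⟩ := r.support_of_check hc
  rw [hA] at hne hg
  rw [← r.curve_eq hA]
  refine ⟨X11b.isElliptic_of_discOf_ne_zero a1 a2 a3 a4 a6 hne,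
    isGloballyMinimal_of_int_criterion a1 a2 a3 a4 a6 fun q hq ⟨h12, h4⟩ => ?_⟩
  have hq1 : (q : ℤ) ∣ discOf [a1, a2, a3, a4, a6] := (dvd_pow_self (q : ℤ) (by norm_num)).trans h12
  have hq2 : (q : ℤ) ∣ c4Of [a1, a2, a3, a4, a6] := (dvd_pow_self (q : ℤ) (by norm_num)).trans h4
  have hdvd : (q : ℤ) ∣ (Int.gcd (discOf [a1, a2, a3, a4, a6]) (c4Of [a1, a2, a3, a4, a6]) : ℤ) :=
    Int.dvd_coe_gcd hq1 hq2
  rw [hg] at hdvd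
  have h1 : q ∣ 1 := by exact_mod_cast hdvd
  exact hq.one_lt.ne' (Nat.dvd_one.mp h1)

/-- The integer model behind the record's curve. [folklore] -/
theorem integralModelInt_eq_of_ainvs [r.curve.IsGloballyMinimal] {a1 a2 a3 a4 a6 : ℤ}
    (hA : r.ainvs = [a1, a2, a3, a4, a6]) : integralModelInt r.curve = ⟨a1, a2, a3, a4, a6⟩ :=
  integralModelInt_eq_of_map_eq _ (by rw [← r.curve_eq hA]; exact map_mk_int a1 a2 a3 a4 a6)

/-- **`ClassX6 W p` for a certified record's curve** (kernel data ⇒ the class predicate): good supersingular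
reduction at the odd prime `p` with `a_p = 0` (`p ∤ Δ`, `#Ẽ(𝔽_p) = p + 1`), semistable (`gcd(Δ, c₄) = 1`),
and the class clause `5 ≤ p ∨ a₃ = 0`. [cite: SilvermanAEC2009, VII.5 Prop. 5.1(a) and (b)] -/
theorem classX6_of_check (hc : r.check = true) [Fact r.p.Prime] [r.curve.IsElliptic] [r.curve.IsGloballyMinimal] :
    ClassX6 r.curve r.p := by
  obtain ⟨a1, a2, a3, a4, a6, hA⟩ := r.exists_ainvs_eq_of_check hc
  obtain ⟨h35, hodd, hΔ, hcnt⟩ := r.reduction_of_check hc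
  have hg := (r.support_of_check hc).2.2
  rw [hA] at hΔ hcnt hg
  have hI := r.integralModelInt_eq_of_ainvs hA
  have hp2 : r.p ≠ 2 := by omega
  have hn := natCard_point_eq_of_countPoints a1 a2 a3 a4 a6 r.p hp2 hΔ (n := r.p + 1) (by rw [hcnt]; push_cast; ring)
  have hgcd : Int.gcd (⟨a1, a2, a3, a4, a6⟩ : WeierstrassCurve ℤ).Δ (⟨a1, a2, a3, a4, a6⟩ : WeierstrassCurve ℤ).c₄ = 1 := by
    rw [intCurve_Δ, intCurve_c₄]; exact hg
  have hΔ' : ¬ (r.p : ℤ) ∣ (⟨a1, a2, a3, a4, a6⟩ : WeierstrassCurve ℤ).Δ := by rw [intCurve_Δ]; exact hΔ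
  have hap : (r.p : ℤ) ∣ (r.p : ℤ) + 1 - ((r.p + 1 : ℕ) : ℤ) := by push_cast; simp
  rcases h35 with h3 | h5
  · -- `p = 3`: good supersingular + semistable from the integer model, and the clause `a₃ = 3 + 1 − 4 = 0`
    have hn4 : Nat.card (((⟨a1, a2, a3, a4, a6⟩ : WeierstrassCurve ℤ).map (Int.castRingHom (ZMod 3))).toAffine.Point) = 4 := by
      have h := hn; rw [h3] at h; simpa using h
    refine ⟨goodSS_of_intModel r.p hI hΔ' hn hap, SecondDescent.semistable_of_intModel_of_gcd_eq_one hI hgcd,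
      Or.inr ?_⟩
    rw [frobeniusTrace_eq hI hn4]; norm_num
  · exact classX6_of_intModel r.p h5 hI hΔ' hn hap hgcd

/-! ### §3 The data of a passing recheck, as `Prop`s -/

/-- Support data of a passing record: every listed `(q, v)` has `q` prime, `q < 504100`, `0 < v`, `q ∤ c₄`,
`q^v ∣ |Δ|`, `q^{v+1} ∤ |Δ|`; `∏ q = N`; `∏ q^v = |Δ|`. [folklore] -/
theorem support_data_of_check (hc : r.check = true) :
    (∀ t ∈ r.bad, t.1.Prime ∧ t.1 < 504100 ∧ 0 < t.2 ∧ ¬ (t.1 : ℤ) ∣ c4Of r.ainvs ∧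
      t.1 ^ t.2 ∣ (discOf r.ainvs).natAbs ∧ ¬ t.1 ^ (t.2 + 1) ∣ (discOf r.ainvs).natAbs) ∧
    r.badPrimes.prod = r.conductor ∧ (r.bad.map fun t => t.1 ^ t.2).prod = (discOf r.ainvs).natAbs := by
  have h' := (r.checks_of_check hc).1
  simp only [checkSupport, Bool.and_eq_true, decide_eq_true_eq, beq_iff_eq, List.all_eq_true] at h'
  obtain ⟨⟨⟨⟨⟨⟨-, hall⟩, -⟩, hN⟩, hΔ⟩, -⟩, -⟩ := h'
  refine ⟨fun t ht => ?_, hN, hΔ⟩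
  obtain ⟨⟨⟨⟨hpr, hv⟩, hc4⟩, hdv⟩, hndv⟩ := hall t ht
  have hlt : t.1 < 504100 := by
    simp only [isPrimeBelow504100, Bool.and_eq_true, decide_eq_true_eq] at hpr; exact hpr.1.2
  exact ⟨prime_of_isPrimeBelow504100 hpr, hlt, hv, fun h => hc4 (Int.emod_eq_zero_of_dvd h),
    Nat.dvd_of_mod_eq_zero hdv, fun h => hndv (Nat.mod_eq_zero_of_dvd h)⟩

/-- A listed bad prime is a listed pair. [folklore] -/
theorem exists_mem_bad_of_mem_badPrimes {q : ℕ} (hq : q ∈ r.badPrimes) : ∃ t ∈ r.bad, t.1 = q := by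
  simpa [badPrimes] using hq

/-- **Every bad prime of a certified record's curve is listed**: a prime of bad reduction divides
`Δ_min = Δ(ainvs)` (Silverman VII.5.1(a) on the minimal model), and the primes dividing `|Δ| = ∏ q^{v_q}` are
the listed ones. [cite: SilvermanAEC2009, VII.5 Prop. 5.1(a)] -/
theorem mem_badPrimes_of_not_good (hc : r.check = true) [r.curve.IsElliptic] [r.curve.IsGloballyMinimal] {ℓ : ℕ}
    (hℓ : ℓ.Prime) (hbad : haveI : Fact ℓ.Prime := ⟨hℓ⟩; ¬ r.curve.HasGoodReductionAtPrime ℓ) :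
    ℓ ∈ r.badPrimes := by
  haveI : Fact ℓ.Prime := ⟨hℓ⟩
  obtain ⟨a1, a2, a3, a4, a6, hA⟩ := r.exists_ainvs_eq_of_check hc
  obtain ⟨hall, -, hΔ⟩ := r.support_data_of_check hc
  have hI := r.integralModelInt_eq_of_ainvs hA
  by_contra hmem
  apply hbad
  apply hasGoodReductionAtPrime_of_not_dvd r.curve ℓ
  intro hdvd
  rw [minimalDiscriminantInt_eq hI, intCurve_Δ, ← hA] at hdvd
  have hnat : ℓ ∣ (discOf r.ainvs).natAbs := Int.natCast_dvd.mp hdvd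
  rw [← hΔ] at hnat
  obtain ⟨x, hx, hℓx⟩ := (Prime.dvd_prod_iff hℓ.prime).mp hnat
  obtain ⟨t, ht, rfl⟩ := List.mem_map.mp hx
  have hq := (hall t ht).1
  have h1 : ℓ ∣ t.1 := hℓ.dvd_of_dvd_pow hℓx
  have h2 : ℓ = t.1 := (Nat.prime_dvd_prime_iff_eq hℓ hq).mp h1
  exact hmem (by rw [badPrimes, List.mem_map]; exact ⟨t, ht, h2.symm⟩)

/-- A listed pair `(q, v)` of a certified record: `E` has multiplicative reduction at `q` and
`ord_q(Δ_min) = v`. [cite: SilvermanAEC2009, VII.5 Prop. 5.1(b)] -/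
theorem mult_and_val_of_mem_bad (hc : r.check = true) [r.curve.IsElliptic] [r.curve.IsGloballyMinimal]
    {t : ℕ × ℕ} (ht : t ∈ r.bad) :
    haveI : Fact t.1.Prime := ⟨((r.support_data_of_check hc).1 t ht).1⟩
    r.curve.HasMultiplicativeReductionAtPrime t.1 ∧ padicValInt t.1 (minimalDiscriminantInt r.curve) = t.2 := by
  obtain ⟨a1, a2, a3, a4, a6, hA⟩ := r.exists_ainvs_eq_of_check hc
  obtain ⟨hall, -, -⟩ := r.support_data_of_check hc
  obtain ⟨hq, -, hv, hc4, hdv, hndv⟩ := hall t ht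
  haveI : Fact t.1.Prime := ⟨hq⟩
  have hI := r.integralModelInt_eq_of_ainvs hA
  rw [hA] at hc4 hdv hndv
  have hdvZ : ((t.1 : ℤ)) ^ t.2 ∣ discOf [a1, a2, a3, a4, a6] := by
    have := Int.natCast_dvd.mpr hdv; exact_mod_cast this
  have hndvZ : ¬ ((t.1 : ℤ)) ^ (t.2 + 1) ∣ discOf [a1, a2, a3, a4, a6] := by
    intro h; apply hndv; have := Int.natCast_dvd.mp (by exact_mod_cast h : (((t.1 ^ (t.2 + 1) : ℕ)) : ℤ) ∣ _); exact this
  refine ⟨hasMultiplicativeReductionAtPrime_of_intModel hI t.1 ?_ ?_, ?_⟩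
  · rw [intCurve_Δ]; exact (dvd_pow_self (t.1 : ℤ) hv.ne').trans hdvZ
  · rw [intCurve_c₄]; exact hc4
  · rw [minimalDiscriminantInt_eq hI, intCurve_Δ]
    exact padicValInt_eq_of_dvd_of_not_dvd t.1 hdvZ hndvZ

/-- Square-freeness from the recheck's trial division: `D < 710²` and no `d ∈ [2, 710)` with `d² ∣ D`.
[folklore] -/
theorem squarefree_of_trial {D : ℕ} (hD : D ≠ 0) (hlt : D < 504100)
    (h : ∀ d < 710, d < 2 ∨ D % (d * d) ≠ 0) : Squarefree D := by
  rw [Nat.squarefree_iff_prime_squarefree]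
  intro x hx hxx
  have hx2 := hx.two_le
  have hle : x * x ≤ D := Nat.le_of_dvd (Nat.pos_of_ne_zero hD) hxx
  have hx710 : x < 710 := by nlinarith
  rcases h x hx710 with hlt2 | hmod
  · omega
  · exact hmod (Nat.mod_eq_zero_of_dvd hxx)

/-! ### §4 The BSTW-scope witness of a certified record (kernel theorem) -/

/-- **`BSTWScope.HasWitness W p` for a certified record with an auxiliary datum and an ODD inert prime.**
The record's `q₀ = auxInert` is a (ram) prime (multiplicative, `p ∤ ord_{q₀}(Δ_min)`) and `L = ℚ(√−D)`,
`D = auxDisc`, satisfies S2 + G3 + (α) of the cell-verified reading of BSTW §10.3: the tree's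
`BSTWScope.hasWitness_of_kronecker` with every hypothesis discharged from the recheck (Kronecker symbols
by Euler's criterion `jacobiSym_eq_one_of_isQR` / `jacobiSym_eq_neg_one_of_isQNR`; `h(−D)` by
`BinaryQuadraticForm.binQF_classNumber_eq`; "every bad prime is listed" by `mem_badPrimes_of_not_good`).
[cite: Cox2013, Thm. 2.13 and §7.B Thm. 7.7(ii)] [cite: SkinnerUrban2014, Thm. 2 (ram)] -/
theorem hasWitness_of_check (hc : r.check = true) [Fact r.p.Prime] [r.curve.IsElliptic]
    [r.curve.IsGloballyMinimal] (hD : r.auxDisc ≠ 0) (hodd : r.auxInert ≠ 2) :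
    BSTWScope.HasWitness r.curve r.p := by
  -- unpack the witness check
  have hw := (r.checks_of_check hc).2.2.2.2.2
  simp only [checkWitness, Bool.or_eq_true, beq_iff_eq, hD, false_or, Bool.and_eq_true,
    decide_eq_true_eq, List.all_eq_true] at hw
  obtain ⟨⟨⟨⟨⟨⟨⟨⟨⟨hD4, hDlt⟩, hsqf⟩, hgcdN⟩, hq0ram⟩, hsp⟩, hall⟩, htwo⟩, hcl⟩, hclp⟩ := hw
  -- unpack the (ram) check at `q₀`
  have hram := (r.checks_of_check hc).2.2.2.2.1
  simp only [checkRam, List.all_eq_true, List.any_eq_true, Bool.and_eq_true, beq_iff_eq,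
    decide_eq_true_eq] at hram
  have hq0mem : r.auxInert ∈ r.ram := by simpa using hq0ram
  obtain ⟨t0, ht0, ⟨ht0q, hq0p⟩, hv0p⟩ := hram _ hq0mem
  obtain ⟨hall', hN, hΔ⟩ := r.support_data_of_check hc
  have hq0 : r.auxInert.Prime := ht0q ▸ (hall' t0 ht0).1
  have hq0lt : r.auxInert < 504100 := ht0q ▸ (hall' t0 ht0).2.1
  haveI hq0F : Fact r.auxInert.Prime := ⟨hq0⟩
  have hp := (Fact.out : r.p.Prime)
  have hp2 : r.p ≠ 2 := (r.three_le_of_check hc).2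
  have hplt : r.p < 504100 := r.p_lt_of_check hc
  set D := r.auxDisc with hDdef
  -- S1: `q₀` is an auxiliary (ram) prime
  have haux : BSTWScope.IsAuxiliaryPrime r.curve r.p r.auxInert := by
    obtain ⟨hmult, hval⟩ := r.mult_and_val_of_mem_bad hc ht0
    refine ⟨hq0p, ?_, ?_⟩
    · simpa [ht0q] using hmult
    · have hval' : padicValInt r.auxInert (minimalDiscriminantInt r.curve) = t0.2 := by simpa [ht0q] using hval
      rw [hval']; intro h; exact hv0p (Nat.mod_eq_zero_of_dvd h)
  -- the discriminant `−D`
  have hD0 : D ≠ 0 := hD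
  have hfund : (-(D : ℤ)) % 4 = 1 ∧ Squarefree (-(D : ℤ)) ∧ (-(D : ℤ)) ≠ 1 := by
    refine ⟨by omega, ?_, by omega⟩
    have hsq : Squarefree D := squarefree_of_trial hD0 hDlt (fun d hd => hsqf d (List.mem_range.mpr hd))
    exact Int.squarefree_natAbs.mp (by simpa using hsq)
  have hsp' : jacobiSym (-(D : ℤ)) r.p = 1 := jacobiSym_eq_one_of_isQR hp hp2 (by omega) hsp
  have hin : jacobiSym (-(D : ℤ)) r.auxInert = -1 := by
    have h := hall r.auxInert (by rw [badPrimes, List.mem_map]; exact ⟨t0, ht0, ht0q⟩)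
    rw [if_pos rfl, if_neg hodd] at h
    exact jacobiSym_eq_neg_one_of_isQNR hq0 hodd (by omega) h
  have hbadD : ∀ ℓ : ℕ, (hℓ : ℓ.Prime) →
      (haveI : Fact ℓ.Prime := ⟨hℓ⟩; ¬ r.curve.HasGoodReductionAtPrime ℓ) → ¬ (ℓ : ℤ) ∣ (D : ℤ) := by
    intro ℓ hℓ hbad hdvd
    have hmem := r.mem_badPrimes_of_not_good hc hℓ hbad
    have hℓN : ℓ ∣ r.conductor := hN ▸ List.dvd_prod hmem
    have hℓD : ℓ ∣ D := by exact_mod_cast hdvd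
    have h1 : ℓ ∣ Nat.gcd D r.conductor := Nat.dvd_gcd hℓD hℓN
    rw [hgcdN] at h1
    exact hℓ.one_lt.ne' (Nat.dvd_one.mp h1)
  have hbad : ∀ ℓ : ℕ, (hℓ : ℓ.Prime) → ℓ ≠ r.auxInert →
      (haveI : Fact ℓ.Prime := ⟨hℓ⟩; ¬ r.curve.HasGoodReductionAtPrime ℓ) →
        (ℓ = 2 → (-(D : ℤ)) % 8 = 1) ∧ (ℓ ≠ 2 → jacobiSym (-(D : ℤ)) ℓ = 1) := by
    intro ℓ hℓ hℓq hbadℓ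
    have hmem := r.mem_badPrimes_of_not_good hc hℓ hbadℓ
    have h := hall ℓ hmem
    rw [if_neg hℓq] at h
    refine ⟨fun h2 => ?_, fun h2 => ?_⟩
    · subst h2; rw [if_pos rfl] at h; simp only [decide_eq_true_eq] at h; omega
    · rw [if_neg h2] at h
      obtain ⟨t, ht, htq⟩ := r.exists_mem_bad_of_mem_badPrimes hmem
      have hlt : ℓ < 504100 := htq ▸ (hall' t ht).2.1
      exact jacobiSym_eq_one_of_isQR hℓ h2 (by omega) h
  have htwo' : r.curve.HasGoodReductionAtPrime 2 → (-(D : ℤ)) % 8 = 1 := by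
    intro hgood
    rcases htwo with h2 | h8
    · exfalso
      have hmem : 2 ∈ r.badPrimes := by simpa using h2
      obtain ⟨t, ht, ht2⟩ := r.exists_mem_bad_of_mem_badPrimes hmem
      obtain ⟨hmult, -⟩ := r.mult_and_val_of_mem_bad hc ht
      have hmult2 : r.curve.HasMultiplicativeReductionAtPrime 2 := by simpa [ht2] using hmult
      exact WeierstrassCurve.HasMultiplicativeReduction.not_hasGoodReduction (R := ℤ_[2]) hmult2 hgood
    · omega
  have hclass : ¬ r.p ∣ BinaryQuadraticForm.classNumber (-(D : ℤ)) := by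
    rw [← BinaryQuadraticForm.binQF_classNumber_eq _ (by omega), ← hcl]
    intro h; exact hclp (Nat.mod_eq_zero_of_dvd h)
  exact BSTWScope.hasWitness_of_kronecker r.curve r.p hp2 r.auxInert haux D hfund hsp' hin hbadD hbad htwo' hclass

end Record

end Summit.BirchSwinnertonDyer.Rank1Residual.X6.PrintCert

end
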